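import Literature.Geometry.Lorentzian.SenWittenStructureEquation
import HarnessLib

/-!
# The curvature of the spin connection of a frame is the Riemann curvature

Sub-brick (ii) of the Lichnerowicz identity in a frame (brick B1a of the analytic engine of
Witten's proof of the positive energy theorem, `SenWittenOperator.lean`): for the spin covariant
derivative `∇ᵥψ = dψ(v) − ¼ Σ ω_{kl}(v) σₖσₗψ` of a smooth global orthonormal frame
(`SenWitten.spinCovDeriv`) and smooth vector fields `U`, `W`,

  `∇_U(∇_Wψ) − ∇_W(∇_Uψ) − ∇_{[U,W]}ψ = −¼ Σₖₗ h(R(U,W)Fₖ, Fₗ) σₖσₗ ψ`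

(`SenWitten.spinCovDeriv_commutator`; Lawson–Michelsohn, *Spin Geometry*, Thm. II.4.15:
`R^S(U,W) = ¼ Σ ⟨R(U,W)eₖ, eₗ⟩ eₖeₗ`, here with `eₖ· = iσₖ`). Ingredients: the derivative of the
connection term (`SenWitten.mvfderiv_spinConnForm_apply`, Leibniz), the bracket of second
derivatives (`mvfderiv_mvfderiv_sub_eq_mvfderiv_mlieBracket`), Cartan's structure equation
(`structure_equation`) and the brute-force Lie-homomorphism property of `a ↦ −¼ Σ a_{kl}σₖσₗ`.
Also: `SenWitten.mvfderiv_fun_sum`, `mdifferentiableAt_fun_sum` (finite sums of vector-valued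
maps on a manifold). All proved; no definitions, no named facts.

## References

* H. B. Lawson, M.-L. Michelsohn, *Spin Geometry*, Princeton 1989, Thm. II.4.15.
  [LawsonMichelsohn1989]
* T. Parker, C. H. Taubes, *On Witten's proof of the positive energy theorem*, Comm. Math. Phys.
  84 (1982) 223–238, §3, (3.1). [ParkerTaubes1982]
-/

noncomputable section

open Bundle Set Function Manifold Finset Filter VectorField
open scoped Manifold ContDiff Topology RealInnerProductSpace

namespace Literature.Geometry.Lorentzian

namespace SenWitten

open PauliModel

variable {X : Type*} [TopologicalSpace X] [ChartedSpace E3 X] [IsManifold (𝓡 3) ∞ X]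
  (D : InitialDataSet (𝓡 3) X) (F : Fin 3 → Π x : X, TangentSpace (𝓡 3) x)

/-! ### Finite sums of vector-valued maps -/

section Sums

variable {V : Type*} [NormedAddCommGroup V] [NormedSpace ℝ V] {ι : Type*}

omit [IsManifold (𝓡 3) ∞ X] in
/-- A finite sum of maps differentiable at `x` is differentiable at `x`. [folklore] -/
theorem mdifferentiableAt_fun_sum (s : Finset ι) {f : ι → X → V} {x : X}
    (h : ∀ i ∈ s, MDifferentiableAt (𝓡 3) 𝓘(ℝ, V) (f i) x) :
    MDifferentiableAt (𝓡 3) 𝓘(ℝ, V) (fun y ↦ ∑ i ∈ s, f i y) x := by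
  classical
  induction s using Finset.induction_on with
  | empty => simpa using mdifferentiableAt_const (I := 𝓡 3) (I' := 𝓘(ℝ, V)) (c := (0 : V))
  | insert a s ha ih =>
    have hfa := h a (Finset.mem_insert_self a s)
    have hs := ih fun i hi ↦ h i (Finset.mem_insert_of_mem hi)
    have heq : (fun y ↦ ∑ i ∈ insert a s, f i y) = fun y ↦ f a y + ∑ i ∈ s, f i y :=
      funext fun y ↦ Finset.sum_insert ha
    rw [heq]
    exact hfa.add hs

omit [IsManifold (𝓡 3) ∞ X] in
/-- **Derivative of a finite sum**: `d(Σᵢ fᵢ) = Σᵢ dfᵢ` for maps differentiable at `x`. [folklore] -/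
theorem mvfderiv_fun_sum (s : Finset ι) {f : ι → X → V} {x : X}
    (h : ∀ i ∈ s, MDifferentiableAt (𝓡 3) 𝓘(ℝ, V) (f i) x) :
    mvfderiv (𝓡 3) (fun y ↦ ∑ i ∈ s, f i y) x = ∑ i ∈ s, mvfderiv (𝓡 3) (f i) x := by
  classical
  induction s using Finset.induction_on with
  | empty => simpa using mvfderiv_const (I := 𝓡 3) (c := (0 : V)) (x := x)
  | insert a s ha ih =>
    have hfa := h a (Finset.mem_insert_self a s)
    have hs' : ∀ i ∈ s, MDifferentiableAt (𝓡 3) 𝓘(ℝ, V) (f i) x :=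
      fun i hi ↦ h i (Finset.mem_insert_of_mem hi)
    have hs := mdifferentiableAt_fun_sum s hs'
    have heq : (fun y ↦ ∑ i ∈ insert a s, f i y) = (f a) + fun y ↦ ∑ i ∈ s, f i y :=
      funext fun y ↦ by simp [Finset.sum_insert ha]
    rw [heq, mvfderiv_add hfa hs, Finset.sum_insert ha, ih hs']

end Sums

/-! ### The derivative of the connection term -/

section Leibniz

variable [D.metric.HasLeviCivita]

/-- **Leibniz rule for the connection term**: for a smooth frame, a smooth field `W` and a smooth
spinor field `ψ`, the derivative of `y ↦ A_y(W_y) ψ(y) = −¼ Σ ω_{kl}(W)(y) σₖσₗψ(y)` along `v` is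
`−¼ Σₖₗ (d(ω_{kl}(W))(v) σₖσₗψ(x) + ω_{kl}(W_x) σₖσₗ dψₓ(v))`. [cite: ParkerTaubes1982, §3] -/
theorem mvfderiv_spinConnForm_apply
    (hF : ∀ i, ContMDiff (𝓡 3) ((𝓡 3).prod 𝓘(ℝ, E3)) ∞
      (fun y ↦ (TotalSpace.mk' E3 y (F i y) : TangentBundle (𝓡 3) X)))
    {W : Π x : X, TangentSpace (𝓡 3) x}
    (hW : ContMDiff (𝓡 3) ((𝓡 3).prod 𝓘(ℝ, E3)) ∞
      (fun y ↦ (TotalSpace.mk' E3 y (W y) : TangentBundle (𝓡 3) X)))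
    {ψ : X → Spinor} (hψ : ContMDiff (𝓡 3) 𝓘(ℝ, Spinor) ∞ ψ) (x : X)
    (v : TangentSpace (𝓡 3) x) :
    mvfderiv (𝓡 3) (fun y ↦ spinConnForm D F y (W y) (ψ y)) x v =
      -((1 / 4 : ℝ) • ∑ k, ∑ l,
        (mvfderiv (𝓡 3) (fun y ↦ connCoeff D F k l y (W y)) x v • pauli k (pauli l (ψ x)) +
          connCoeff D F k l x (W x) • pauli k (pauli l (mvfderiv (𝓡 3) ψ x v)))) := by
  have hfun : (fun y ↦ spinConnForm D F y (W y) (ψ y)) =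
      -((fun _ : X ↦ (1 / 4 : ℝ)) • fun y ↦ ∑ k, ∑ l,
        connCoeff D F k l y (W y) • pauli k (pauli l (ψ y))) := by
    funext y
    simp only [Pi.neg_apply, Pi.smul_apply', spinConnForm_apply]
  have hc : ∀ k l, MDifferentiableAt (𝓡 3) 𝓘(ℝ, ℝ) (fun y ↦ connCoeff D F k l y (W y)) x :=
    fun k l ↦ (contMDiff_connCoeff_apply D F hF hW k l x).mdifferentiableAt (by simp)
  have hψx : MDifferentiableAt (𝓡 3) 𝓘(ℝ, Spinor) ψ x := (hψ x).mdifferentiableAt (by simp)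
  have hLψ : ∀ k l, MDifferentiableAt (𝓡 3) 𝓘(ℝ, Spinor) (fun y ↦ pauli k (pauli l (ψ y))) x :=
    fun k l ↦ SenParallel.mdifferentiableAt_clm_apply_comp _
      (SenParallel.mdifferentiableAt_clm_apply_comp _ hψx)
  have hterm : ∀ k l, MDifferentiableAt (𝓡 3) 𝓘(ℝ, Spinor)
      (fun y ↦ connCoeff D F k l y (W y) • pauli k (pauli l (ψ y))) x :=
    fun k l ↦ (hc k l).smul (hLψ k l)
  have hinner : ∀ k, MDifferentiableAt (𝓡 3) 𝓘(ℝ, Spinor)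
      (fun y ↦ ∑ l, connCoeff D F k l y (W y) • pauli k (pauli l (ψ y))) x :=
    fun k ↦ mdifferentiableAt_fun_sum _ fun l _ ↦ hterm k l
  have hsum : MDifferentiableAt (𝓡 3) 𝓘(ℝ, Spinor)
      (fun y ↦ ∑ k, ∑ l, connCoeff D F k l y (W y) • pauli k (pauli l (ψ y))) x :=
    mdifferentiableAt_fun_sum _ fun k _ ↦ hinner k
  rw [hfun, mvfderiv_neg, mvfderiv_smul mdifferentiableAt_const hsum, mvfderiv_const,
    mvfderiv_fun_sum _ (fun k _ ↦ hinner k)]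
  simp only [_root_.neg_apply, _root_.add_apply, FunLike.coe_smul, Pi.smul_apply,
    ContinuousLinearMap.smulRight_apply, _root_.zero_apply, zero_smul, add_zero,
    FunLike.coe_sum, Finset.sum_apply]
  congr 1
  congr 1
  refine Finset.sum_congr rfl fun k _ ↦ ?_
  rw [mvfderiv_fun_sum _ (fun l _ ↦ hterm k l)]
  simp only [FunLike.coe_sum, Finset.sum_apply]
  refine Finset.sum_congr rfl fun l _ ↦ ?_
  have hsm : (fun y ↦ connCoeff D F k l y (W y) • pauli k (pauli l (ψ y))) =
      (fun y ↦ connCoeff D F k l y (W y)) • fun y ↦ pauli k (pauli l (ψ y)) := rfl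
  rw [hsm, mvfderiv_smul (hc k l) (hLψ k l)]
  simp only [_root_.add_apply, FunLike.coe_smul, Pi.smul_apply,
    ContinuousLinearMap.smulRight_apply]
  rw [SenParallel.mvfderiv_clm_apply_comp _ (SenParallel.mdifferentiableAt_clm_apply_comp _ hψx),
    SenParallel.mvfderiv_clm_apply_comp _ hψx, add_comm]

end Leibniz

/-! ### The spin curvature -/

section Curvature

variable [D.metric.HasLeviCivita]

/-- **The curvature of the spin connection is the Riemann curvature**: for a smooth orthonormal
frame, smooth vector fields `U`, `W` and a smooth spinor field `ψ`,
`∇_U(∇_Wψ) − ∇_W(∇_Uψ) − ∇_{[U,W]}ψ = −¼ Σₖₗ h(R(U,W)Fₖ, Fₗ) σₖσₗψ` pointwise.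
Lawson–Michelsohn 1989, Thm. II.4.15. [cite: LawsonMichelsohn1989, Thm. II.4.15] -/
theorem spinCovDeriv_commutator
    (hF : ∀ i, ContMDiff (𝓡 3) ((𝓡 3).prod 𝓘(ℝ, E3)) ∞
      (fun y ↦ (TotalSpace.mk' E3 y (F i y) : TangentBundle (𝓡 3) X)))
    (horth : ∀ x i j, D.h.inner x (F i x) (F j x) = if i = j then 1 else 0)
    {U W : Π x : X, TangentSpace (𝓡 3) x}
    (hU : ContMDiff (𝓡 3) ((𝓡 3).prod 𝓘(ℝ, E3)) ∞
      (fun y ↦ (TotalSpace.mk' E3 y (U y) : TangentBundle (𝓡 3) X)))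
    (hW : ContMDiff (𝓡 3) ((𝓡 3).prod 𝓘(ℝ, E3)) ∞
      (fun y ↦ (TotalSpace.mk' E3 y (W y) : TangentBundle (𝓡 3) X)))
    {ψ : X → Spinor} (hψ : ContMDiff (𝓡 3) 𝓘(ℝ, Spinor) ∞ ψ) (x : X) :
    spinCovDeriv D F (fun y ↦ spinCovDeriv D F ψ y (W y)) x (U x) -
        spinCovDeriv D F (fun y ↦ spinCovDeriv D F ψ y (U y)) x (W x) -
        spinCovDeriv D F ψ x (mlieBracket (𝓡 3) U W x) =
      -((1 / 4 : ℝ) • ∑ k, ∑ l,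
        D.metric.val x (D.metric.riemann x (U x) (W x) (F k x)) (F l x) •
          pauli k (pauli l (ψ x))) := by
  -- differentiability of the pieces of `∇_Vψ = dψ(V) + A(V)ψ`
  have hψx : MDifferentiableAt (𝓡 3) 𝓘(ℝ, Spinor) ψ x := (hψ x).mdifferentiableAt (by simp)
  have hdW : MDifferentiableAt (𝓡 3) 𝓘(ℝ, Spinor) (fun y ↦ mvfderiv (𝓡 3) ψ y (W y)) x :=
    (contMDiff_mvfderiv_apply hW hψ x).mdifferentiableAt (by simp)
  have hdU : MDifferentiableAt (𝓡 3) 𝓘(ℝ, Spinor) (fun y ↦ mvfderiv (𝓡 3) ψ y (U y)) x :=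
    (contMDiff_mvfderiv_apply hU hψ x).mdifferentiableAt (by simp)
  have hGW : MDifferentiableAt (𝓡 3) 𝓘(ℝ, Spinor) (fun y ↦ spinConnForm D F y (W y) (ψ y)) x :=
    (contMDiff_spinConnForm_apply D F hF hW hψ x).mdifferentiableAt (by simp)
  have hGU : MDifferentiableAt (𝓡 3) 𝓘(ℝ, Spinor) (fun y ↦ spinConnForm D F y (U y) (ψ y)) x :=
    (contMDiff_spinConnForm_apply D F hF hU hψ x).mdifferentiableAt (by simp)
  -- expand the outer covariant derivatives
  simp only [spinCovDeriv_apply]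
  rw [mvfderiv_fun_add hdW hGW, mvfderiv_fun_add hdU hGU]
  simp only [_root_.add_apply, map_add]
  -- the three geometric inputs
  have h2 : (2 : ℕ∞ω) ≤ ∞ := WithTop.coe_le_coe.mpr le_top
  have E3 := mvfderiv_mvfderiv_sub_eq_mvfderiv_mlieBracket ((hψ x).of_le h2)
    ((hU x).of_le h2) ((hW x).of_le h2)
  have E4 : ∀ k l, mvfderiv (𝓡 3) (fun y ↦ connCoeff D F k l y (W y)) x (U x) =
      mvfderiv (𝓡 3) (fun y ↦ connCoeff D F k l y (U y)) x (W x) +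
        connCoeff D F k l x (mlieBracket (𝓡 3) U W x) +
        (D.metric.val x (D.metric.riemann x (U x) (W x) (F k x)) (F l x) +
          ∑ m, (connCoeff D F k m x (W x) * connCoeff D F l m x (U x) -
            connCoeff D F k m x (U x) * connCoeff D F l m x (W x))) := by
    intro k l
    have h := structure_equation D F hF horth hU hW k l x
    rw [← h]
    abel
  have hanti : ∀ (v : TangentSpace (𝓡 3) x) i j, connCoeff D F i j x v = -connCoeff D F j i x v :=
    fun v i j ↦ SenParallel.val_leviCivita_frame_antisymm D
      (fun i x ↦ (hF i x).mdifferentiableAt (by simp)) horth x v i j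
  have hdiag : ∀ (v : TangentSpace (𝓡 3) x) i, connCoeff D F i i x v = 0 :=
    fun v i ↦ by linarith [hanti v i i]
  rw [mvfderiv_spinConnForm_apply D F hF hW hψ x (U x),
    mvfderiv_spinConnForm_apply D F hF hU hψ x (W x), ← E3]
  simp only [E4]
  -- antisymmetry of `ω(U)`, `ω(W)`, `ω([U,W])` and of the derivative coefficients is not needed
  -- beyond the diagonal/orientation rules; normalise the Pauli words and compare coefficients
  have a10 := hanti (U x) 1 0
  have a20 := hanti (U x) 2 0
  have a21 := hanti (U x) 2 1
  have b10 := hanti (W x) 1 0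
  have b20 := hanti (W x) 2 0
  have b21 := hanti (W x) 2 1
  have hsq := pauli_sq
  have ha01 := pauli_anticomm (show (0 : Fin 3) ≠ 1 by decide)
  have ha02 := pauli_anticomm (show (0 : Fin 3) ≠ 2 by decide)
  have ha12 := pauli_anticomm (show (1 : Fin 3) ≠ 2 by decide)
  simp only [spinConnForm_apply, Fin.sum_univ_three, hdiag, a10, a20, a21, b10, b20, b21,
    zero_smul, zero_add, add_zero, hsq, ha01, ha02, ha12, map_neg, map_add, map_smul,
    smul_neg, neg_smul, neg_neg, smul_add, add_smul, sub_smul, mul_zero, zero_mul, sub_zero,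
    mul_neg, neg_mul]
  module

end Curvature

end SenWitten

end Literature.Geometry.Lorentzian

end
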